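import Summits.CriticalPhenomena.PercolationContinuityZ3.Theorems.PercNearOneGluingNoHeavyLowerTailKnQuestion8CoefficientwiseCoreClassKernelMix
import HarnessLib

/-!
# KB-MIX, the transfer inequality of the leaf step

Support file (`--supports stmt-CriticalPhenomena-4575`, closed), prover `prim-cplus-coupling` (gen 31).  No definitions, no notations, no named facts,
no sorries; standard axioms.  Memo `prim-cplus-coupling/A5-COUPLING-gen31.md` §1.3.  Companion of `…CoreClassKernelMix` (the invariant KB-MIX) and
`…CoreClassKernelMixLeaf` (the leaf step, which is THIS inequality plus one instance of KB-MIX of the smaller graph).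

Setting: middle graph `E`, terminals `a, b`, `C_v(ω) = openCluster (ends '' ω) v`, `P = C_a ω`, `Q = C_b(E∖ω)`, `S = C_a ω ∪ C_b ω`,
`ℜ = {b ∈ C_a ω}`, `𝔅 = {a ∈ C_b(E∖ω)}`.  When a terminal leaf `e = a′a` is hung at `a`, the KB-MIX expression of `(insert e E; a′, b)` splits along
the colour of `e` into an instance of KB-MIX for `(E; a, b)` (the `e`-red supply off `ℜ` and the wall part of the `e`-red anti-term) and a REMAINDER
which involves only the graph `E` and the level functions `h₁ = h(a′ ∪ ·)`, `hᵃ₁ = hᵃ(a′ ∪ ·)`, `hᵇ₀ = hᵇ`, … (memo §1.3):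
  `Σ_ω h₁k₁(C_b ω) + Σ_{ω ∉ 𝔅} (αₕ − hᵇ₀ Q)(αₖ − kᵇ₀ Q) + Σ_{ω ∈ 𝔅 ∖ ℜ} (hᵃ₁ P − hᵇ₀ Q)(kᵃ₁ P − kᵇ₀ Q)`,  `αₕ = hᵃ{a′} ≤ h₁ ∅`.
* `Coefficientwise.coreClass_kernelMix_transfer` — **the remainder is `≥ 0`** for all `h₁, k₁` and monotone levels
  `0 ≤ hᵃ₁, hᵇ₀ ≤ h₁`, `0 ≤ kᵃ₁, kᵇ₀ ≤ k₁`, `0 ≤ αₕ ≤ h₁`, `0 ≤ αₖ ≤ k₁`.  Proof (generic, no hypothesis on `E`): the `𝔅ᶜ` terms are paid termwise by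
  the first sum at the swapped colouring (`C_b(E∖ω̄)`... i.e. `h₁k₁(Q) + (αₕ − hᵇ₀Q)(αₖ − kᵇ₀Q) ≥ 0`); on `𝔅 ∖ ℜ` the two cross terms `hᵃ₁(P)kᵇ₀(Q)`,
  `kᵃ₁(P)hᵇ₀(Q)` are each bounded through ONE two-colouring Harris inequality (`P` increasing, `Q·1_{𝔅∖ℜ}` decreasing; the swap carries `𝔅 ∖ ℜ` to
  `ℜ ∖ 𝔅`, where `C_b = C_a = S`) by `Σ_{ℜ∖𝔅} hᵃ₁(S)kᵇ₀(S)` resp. `Σ_{ℜ∖𝔅} kᵃ₁(S)hᵇ₀(S)`, the square `hᵇ₀kᵇ₀(Q)` swaps to `Σ_{ℜ∖𝔅} hᵇ₀kᵇ₀(S)`, and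
  with ONE copy of the first sum on `ℜ ∖ 𝔅` the pointwise inequality `h₁k₁ + hᵇ₀kᵇ₀ − hᵃ₁kᵇ₀ − kᵃ₁hᵇ₀ ≥ (h₁ − hᵇ₀)(k₁ − kᵇ₀) ≥ 0` (`kernelMix_pointwise`)
  closes.  This is the negative dependence of the red cluster of `a` and the blue cluster of `b` (THEOREM LEAF's mechanism) in level-book-keeping form.
[cite: KozmaNitzan2024, Questions 8–9 (§5.5 p. 36) (context: the Question-8 pocket covariance programme)]
-/

namespace Summit.CriticalPhenomena.PercolationContinuityZ3.Theorems

open Finset Literature.Probability.Percolation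

namespace Coefficientwise

variable {ι V : Type*}

open Classical in
/-- **KB-MIX transfer inequality** (the remainder of the leaf step; generic in the middle graph).  For a finite multigraph (`ends`, edge set `E`),
vertices `a, b`, functions `h₁, k₁` and monotone `hᵃ₁, hᵇ₀, kᵃ₁, kᵇ₀ : Set V → ℝ` with `0 ≤ hᵃ₁, hᵇ₀ ≤ h₁`, `0 ≤ kᵃ₁, kᵇ₀ ≤ k₁`, and constants `0 ≤ αₕ ≤ h₁`,
`0 ≤ αₖ ≤ k₁` (pointwise):
`0 ≤ Σ_{ω ⊆ E} h₁(C_b ω)k₁(C_b ω) + Σ_{ω : a ∉ C_b(E∖ω)} (αₕ − hᵇ₀(C_b(E∖ω)))(αₖ − kᵇ₀(C_b(E∖ω)))`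
`      + Σ_{ω : b ∉ C_a ω, a ∈ C_b(E∖ω)} (hᵃ₁(C_a ω) − hᵇ₀(C_b(E∖ω)))(kᵃ₁(C_a ω) − kᵇ₀(C_b(E∖ω)))`.
[cite: KozmaNitzan2024, Questions 8–9 (§5.5 p. 36) (context)] -/
theorem coreClass_kernelMix_transfer (ends : ι → Sym2 V) (E : Finset ι) (a b : V) (h₁ k₁ ha₁ hb₀ ka₁ kb₀ : Set V → ℝ) (αh αk : ℝ)
    (mha : Monotone ha₁) (mhb : Monotone hb₀) (mka : Monotone ka₁) (mkb : Monotone kb₀)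
    (ha0 : ∀ X, 0 ≤ ha₁ X) (hah : ∀ X, ha₁ X ≤ h₁ X) (hb0 : ∀ X, 0 ≤ hb₀ X) (hbh : ∀ X, hb₀ X ≤ h₁ X)
    (ka0 : ∀ X, 0 ≤ ka₁ X) (kak : ∀ X, ka₁ X ≤ k₁ X) (kb0 : ∀ X, 0 ≤ kb₀ X) (kbk : ∀ X, kb₀ X ≤ k₁ X)
    (hα0 : 0 ≤ αh) (hα : ∀ X, αh ≤ h₁ X) (hα0' : 0 ≤ αk) (hα' : ∀ X, αk ≤ k₁ X) :
    0 ≤ (∑ ω ∈ E.powerset, h₁ (openCluster (ends '' (↑ω : Set ι)) b) * k₁ (openCluster (ends '' (↑ω : Set ι)) b))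
      + (∑ ω ∈ E.powerset, if a ∉ openCluster (ends '' (↑(E \ ω) : Set ι)) b then
          (αh - hb₀ (openCluster (ends '' (↑(E \ ω) : Set ι)) b)) * (αk - kb₀ (openCluster (ends '' (↑(E \ ω) : Set ι)) b)) else 0)
      + ∑ ω ∈ E.powerset, if b ∉ openCluster (ends '' (↑ω : Set ι)) a ∧ a ∈ openCluster (ends '' (↑(E \ ω) : Set ι)) b then
          (ha₁ (openCluster (ends '' (↑ω : Set ι)) a) - hb₀ (openCluster (ends '' (↑(E \ ω) : Set ι)) b)) *
            (ka₁ (openCluster (ends '' (↑ω : Set ι)) a) - kb₀ (openCluster (ends '' (↑(E \ ω) : Set ι)) b)) else 0 := by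
  set C : Finset ι → V → Set V := fun ω v => openCluster (ends '' (↑ω : Set ι)) v with hC
  change 0 ≤ (∑ ω ∈ E.powerset, h₁ (C ω b) * k₁ (C ω b))
      + (∑ ω ∈ E.powerset, if a ∉ C (E \ ω) b then (αh - hb₀ (C (E \ ω) b)) * (αk - kb₀ (C (E \ ω) b)) else 0)
      + ∑ ω ∈ E.powerset, if b ∉ C ω a ∧ a ∈ C (E \ ω) b then (ha₁ (C ω a) - hb₀ (C (E \ ω) b)) * (ka₁ (C ω a) - kb₀ (C (E \ ω) b)) else 0
  have hh0 : ∀ X, 0 ≤ h₁ X := fun X => le_trans (ha0 X) (hah X)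
  have hk0 : ∀ X, 0 ≤ k₁ X := fun X => le_trans (ka0 X) (kak X)
  have hCmono : ∀ {ω ω' : Finset ι} (v : V), ω ⊆ ω' → C ω v ⊆ C ω' v := fun v hle => openCluster_image_mono ends hle v
  -- (i) the `𝔅ᶜ` anti terms against the first family at the swapped colouring, termwise
  have step_i : 0 ≤ ∑ ω ∈ E.powerset, ((if a ∉ C (E \ ω) b then (αh - hb₀ (C (E \ ω) b)) * (αk - kb₀ (C (E \ ω) b)) else 0)
      + (if a ∉ C (E \ ω) b then h₁ (C (E \ ω) b) * k₁ (C (E \ ω) b) else 0)) := by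
    refine Finset.sum_nonneg fun ω _ => ?_
    by_cases hw : a ∉ C (E \ ω) b
    · rw [if_pos hw, if_pos hw]
      have := mul_add_sub_mul_sub_nonneg (A := h₁ (C (E \ ω) b)) (B := k₁ (C (E \ ω) b)) (α := αh) (β := hb₀ (C (E \ ω) b))
        (γ := αk) (δ := kb₀ (C (E \ ω) b)) hα0 (hα _) (hb0 _) (hbh _) hα0' (hα' _) (kb0 _) (kbk _)
      linarith
    · rw [if_neg hw, if_neg hw]; linarith
  -- the first family re-indexed by the swap, and split along `a ∈ C ω b`
  have swap_i : ∑ ω ∈ E.powerset, (if a ∉ C (E \ ω) b then h₁ (C (E \ ω) b) * k₁ (C (E \ ω) b) else 0) =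
      ∑ ω ∈ E.powerset, (if a ∉ C ω b then h₁ (C ω b) * k₁ (C ω b) else 0) :=
    sum_powerset_sdiff E (fun ω => if a ∉ C ω b then h₁ (C ω b) * k₁ (C ω b) else 0)
  have H1split : ∑ ω ∈ E.powerset, h₁ (C ω b) * k₁ (C ω b) =
      ∑ ω ∈ E.powerset, (if a ∉ C ω b then h₁ (C ω b) * k₁ (C ω b) else 0)
      + ∑ ω ∈ E.powerset, (if a ∈ C ω b then h₁ (C ω b) * k₁ (C ω b) else 0) := by
    rw [← Finset.sum_add_distrib]
    refine Finset.sum_congr rfl fun ω _ => ?_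
    by_cases hab : a ∈ C ω b
    · rw [if_neg (not_not.mpr hab), if_pos hab]; ring
    · rw [if_pos hab, if_neg hab]; ring
  -- the part `a ∈ C ω b` of the first family dominates its restriction to `ℜ ∖ 𝔅`, where `C ω b = S`
  have H1on : ∑ ω ∈ E.powerset, (if b ∈ C ω a ∧ a ∉ C (E \ ω) b then h₁ (C ω a ∪ C ω b) * k₁ (C ω a ∪ C ω b) else 0) ≤
      ∑ ω ∈ E.powerset, (if a ∈ C ω b then h₁ (C ω b) * k₁ (C ω b) else 0) := by
    refine Finset.sum_le_sum fun ω _ => ?_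
    by_cases h1 : b ∈ C ω a ∧ a ∉ C (E \ ω) b
    · have hab : a ∈ C ω b := (mem_openCluster_comm ends ω a b).mp h1.1
      have hU : C ω a ∪ C ω b = C ω b :=
        Set.union_eq_right.mpr (fun y hy => SimpleGraph.Reachable.trans (SimpleGraph.Reachable.symm h1.1) hy)
      rw [if_pos h1, if_pos hab, hU]
    · rw [if_neg h1]
      by_cases hab : a ∈ C ω b
      · rw [if_pos hab]; exact mul_nonneg (hh0 _) (hk0 _)
      · rw [if_neg hab]
  -- (iii) first cross term: F = hᵃ₁(C ω a) increasing, G = kᵇ₀(S)·1[ℜ ∖ 𝔅] increasing; Harris Σ F(ω)G(E∖ω) ≤ Σ F(ω)G(ω)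
  have cross1 : ∑ ω ∈ E.powerset, (if b ∉ C ω a ∧ a ∈ C (E \ ω) b then ha₁ (C ω a) * kb₀ (C (E \ ω) b) else 0)
      ≤ ∑ ω ∈ E.powerset, (if b ∈ C ω a ∧ a ∉ C (E \ ω) b then ha₁ (C ω a ∪ C ω b) * kb₀ (C ω a ∪ C ω b) else 0) := by
    set F : Finset ι → ℝ := fun ω => ha₁ (C ω a) with hF
    set G : Finset ι → ℝ := fun ω => if b ∈ C ω a ∧ a ∉ C (E \ ω) b then kb₀ (C ω a ∪ C ω b) else 0 with hG
    have hFm : Monotone F := fun ω ω' hle => mha (hCmono a hle)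
    have hGm : Monotone G := by
      intro ω ω' hle
      simp only [hG]
      by_cases h1 : b ∈ C ω a ∧ a ∉ C (E \ ω) b
      · have h1' : b ∈ C ω' a ∧ a ∉ C (E \ ω') b :=
          ⟨hCmono a hle h1.1, fun h' => h1.2 (hCmono b (Finset.sdiff_subset_sdiff (le_refl E) hle) h')⟩
        rw [if_pos h1, if_pos h1']
        exact mkb (Set.union_subset_union (hCmono a hle) (hCmono b hle))
      · rw [if_neg h1]
        by_cases h2 : b ∈ C ω' a ∧ a ∉ C (E \ ω') b
        · rw [if_pos h2]; exact kb0 _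
        · rw [if_neg h2]
    have key := sum_mul_sdiff_le_sum_mul E F G hFm hGm
    have lhs_eq : ∑ ω ∈ E.powerset, F ω * G (E \ ω) =
        ∑ ω ∈ E.powerset, (if b ∉ C ω a ∧ a ∈ C (E \ ω) b then ha₁ (C ω a) * kb₀ (C (E \ ω) b) else 0) := by
      refine Finset.sum_congr rfl fun ω hω => ?_
      have hω := Finset.mem_powerset.mp hω
      simp only [hF, hG]
      rw [Finset.sdiff_sdiff_eq_self hω]
      by_cases h1 : b ∉ C ω a ∧ a ∈ C (E \ ω) b
      · have hba : b ∈ C (E \ ω) a := (mem_openCluster_comm ends (E \ ω) a b).mpr h1.2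
        have hab' : a ∉ C ω b := fun h' => h1.1 ((mem_openCluster_comm ends ω a b).mpr h')
        have hU : C (E \ ω) a ∪ C (E \ ω) b = C (E \ ω) b :=
          Set.union_eq_right.mpr (fun y hy => SimpleGraph.Reachable.trans (SimpleGraph.Reachable.symm hba) hy)
        rw [if_pos ⟨hba, hab'⟩, if_pos h1, hU]
      · have h1' : ¬ (b ∈ C (E \ ω) a ∧ a ∉ C ω b) := by
          intro h'; apply h1
          exact ⟨fun h'' => h'.2 ((mem_openCluster_comm ends ω a b).mp h''), (mem_openCluster_comm ends (E \ ω) a b).mp h'.1⟩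
        rw [if_neg h1', if_neg h1, mul_zero]
    have rhs_le : ∑ ω ∈ E.powerset, F ω * G ω ≤
        ∑ ω ∈ E.powerset, (if b ∈ C ω a ∧ a ∉ C (E \ ω) b then ha₁ (C ω a ∪ C ω b) * kb₀ (C ω a ∪ C ω b) else 0) := by
      refine Finset.sum_le_sum fun ω _ => ?_
      simp only [hF, hG]
      by_cases h1 : b ∈ C ω a ∧ a ∉ C (E \ ω) b
      · rw [if_pos h1, if_pos h1]
        exact mul_le_mul_of_nonneg_right (mha Set.subset_union_left) (kb0 _)
      · rw [if_neg h1, if_neg h1, mul_zero]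
    linarith
  -- second cross term: F = kᵃ₁(C ω a), G = hᵇ₀(S)·1[ℜ ∖ 𝔅]
  have cross2 : ∑ ω ∈ E.powerset, (if b ∉ C ω a ∧ a ∈ C (E \ ω) b then ka₁ (C ω a) * hb₀ (C (E \ ω) b) else 0)
      ≤ ∑ ω ∈ E.powerset, (if b ∈ C ω a ∧ a ∉ C (E \ ω) b then ka₁ (C ω a ∪ C ω b) * hb₀ (C ω a ∪ C ω b) else 0) := by
    set F : Finset ι → ℝ := fun ω => ka₁ (C ω a) with hF
    set G : Finset ι → ℝ := fun ω => if b ∈ C ω a ∧ a ∉ C (E \ ω) b then hb₀ (C ω a ∪ C ω b) else 0 with hG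
    have hFm : Monotone F := fun ω ω' hle => mka (hCmono a hle)
    have hGm : Monotone G := by
      intro ω ω' hle
      simp only [hG]
      by_cases h1 : b ∈ C ω a ∧ a ∉ C (E \ ω) b
      · have h1' : b ∈ C ω' a ∧ a ∉ C (E \ ω') b :=
          ⟨hCmono a hle h1.1, fun h' => h1.2 (hCmono b (Finset.sdiff_subset_sdiff (le_refl E) hle) h')⟩
        rw [if_pos h1, if_pos h1']
        exact mhb (Set.union_subset_union (hCmono a hle) (hCmono b hle))
      · rw [if_neg h1]
        by_cases h2 : b ∈ C ω' a ∧ a ∉ C (E \ ω') b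
        · rw [if_pos h2]; exact hb0 _
        · rw [if_neg h2]
    have key := sum_mul_sdiff_le_sum_mul E F G hFm hGm
    have lhs_eq : ∑ ω ∈ E.powerset, F ω * G (E \ ω) =
        ∑ ω ∈ E.powerset, (if b ∉ C ω a ∧ a ∈ C (E \ ω) b then ka₁ (C ω a) * hb₀ (C (E \ ω) b) else 0) := by
      refine Finset.sum_congr rfl fun ω hω => ?_
      have hω := Finset.mem_powerset.mp hω
      simp only [hF, hG]
      rw [Finset.sdiff_sdiff_eq_self hω]
      by_cases h1 : b ∉ C ω a ∧ a ∈ C (E \ ω) b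
      · have hba : b ∈ C (E \ ω) a := (mem_openCluster_comm ends (E \ ω) a b).mpr h1.2
        have hab' : a ∉ C ω b := fun h' => h1.1 ((mem_openCluster_comm ends ω a b).mpr h')
        have hU : C (E \ ω) a ∪ C (E \ ω) b = C (E \ ω) b :=
          Set.union_eq_right.mpr (fun y hy => SimpleGraph.Reachable.trans (SimpleGraph.Reachable.symm hba) hy)
        rw [if_pos ⟨hba, hab'⟩, if_pos h1, hU]
      · have h1' : ¬ (b ∈ C (E \ ω) a ∧ a ∉ C ω b) := by
          intro h'; apply h1
          exact ⟨fun h'' => h'.2 ((mem_openCluster_comm ends ω a b).mp h''), (mem_openCluster_comm ends (E \ ω) a b).mp h'.1⟩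
        rw [if_neg h1', if_neg h1, mul_zero]
    have rhs_le : ∑ ω ∈ E.powerset, F ω * G ω ≤
        ∑ ω ∈ E.powerset, (if b ∈ C ω a ∧ a ∉ C (E \ ω) b then ka₁ (C ω a ∪ C ω b) * hb₀ (C ω a ∪ C ω b) else 0) := by
      refine Finset.sum_le_sum fun ω _ => ?_
      simp only [hF, hG]
      by_cases h1 : b ∈ C ω a ∧ a ∉ C (E \ ω) b
      · rw [if_pos h1, if_pos h1]
        exact mul_le_mul_of_nonneg_right (mka Set.subset_union_left) (hb0 _)
      · rw [if_neg h1, if_neg h1, mul_zero]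
    linarith
  -- the square `hᵇ₀kᵇ₀(Q)` on `𝔅 ∖ ℜ` swaps to `hᵇ₀kᵇ₀(S)` on `ℜ ∖ 𝔅`
  have sq_swap : ∑ ω ∈ E.powerset, (if b ∉ C ω a ∧ a ∈ C (E \ ω) b then hb₀ (C (E \ ω) b) * kb₀ (C (E \ ω) b) else 0) =
      ∑ ω ∈ E.powerset, (if b ∈ C ω a ∧ a ∉ C (E \ ω) b then hb₀ (C ω a ∪ C ω b) * kb₀ (C ω a ∪ C ω b) else 0) := by
    have hs : ∑ ω ∈ E.powerset, (if b ∉ C (E \ (E \ ω)) a ∧ a ∈ C (E \ ω) b then hb₀ (C (E \ ω) b) * kb₀ (C (E \ ω) b) else 0) =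
        ∑ ω ∈ E.powerset, (if b ∉ C (E \ ω) a ∧ a ∈ C ω b then hb₀ (C ω b) * kb₀ (C ω b) else 0) :=
      sum_powerset_sdiff E (fun ω => if b ∉ C (E \ ω) a ∧ a ∈ C ω b then hb₀ (C ω b) * kb₀ (C ω b) else 0)
    have lhs : ∑ ω ∈ E.powerset, (if b ∉ C (E \ (E \ ω)) a ∧ a ∈ C (E \ ω) b then hb₀ (C (E \ ω) b) * kb₀ (C (E \ ω) b) else 0) =
        ∑ ω ∈ E.powerset, (if b ∉ C ω a ∧ a ∈ C (E \ ω) b then hb₀ (C (E \ ω) b) * kb₀ (C (E \ ω) b) else 0) := by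
      refine Finset.sum_congr rfl fun ω hω => ?_
      rw [Finset.sdiff_sdiff_eq_self (Finset.mem_powerset.mp hω)]
    rw [← lhs, hs]
    refine Finset.sum_congr rfl fun ω _ => ?_
    by_cases h1 : b ∉ C (E \ ω) a ∧ a ∈ C ω b
    · have hba : b ∈ C ω a := (mem_openCluster_comm ends ω a b).mpr h1.2
      have hab : a ∉ C (E \ ω) b := fun h' => h1.1 ((mem_openCluster_comm ends (E \ ω) a b).mpr h')
      have hU : C ω a ∪ C ω b = C ω b :=
        Set.union_eq_right.mpr (fun y hy => SimpleGraph.Reachable.trans (SimpleGraph.Reachable.symm hba) hy)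
      rw [if_pos h1, if_pos ⟨hba, hab⟩, hU]
    · have h1' : ¬ (b ∈ C ω a ∧ a ∉ C (E \ ω) b) := by
        intro h'; apply h1
        exact ⟨fun h'' => h'.2 ((mem_openCluster_comm ends (E \ ω) a b).mp h''), (mem_openCluster_comm ends ω a b).mp h'.1⟩
      rw [if_neg h1, if_neg h1']
  -- (iii) termwise expansion of the `𝔅 ∖ ℜ` anti terms, dropping the square `hᵃ₁kᵃ₁(P) ≥ 0`
  have step_iii : (∑ ω ∈ E.powerset, (if b ∉ C ω a ∧ a ∈ C (E \ ω) b then hb₀ (C (E \ ω) b) * kb₀ (C (E \ ω) b) else 0))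
      - (∑ ω ∈ E.powerset, (if b ∉ C ω a ∧ a ∈ C (E \ ω) b then ha₁ (C ω a) * kb₀ (C (E \ ω) b) else 0))
      - (∑ ω ∈ E.powerset, (if b ∉ C ω a ∧ a ∈ C (E \ ω) b then ka₁ (C ω a) * hb₀ (C (E \ ω) b) else 0))
      ≤ ∑ ω ∈ E.powerset, (if b ∉ C ω a ∧ a ∈ C (E \ ω) b then
          (ha₁ (C ω a) - hb₀ (C (E \ ω) b)) * (ka₁ (C ω a) - kb₀ (C (E \ ω) b)) else 0) := by
    rw [← Finset.sum_sub_distrib, ← Finset.sum_sub_distrib]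
    refine Finset.sum_le_sum fun ω _ => ?_
    by_cases h1 : b ∉ C ω a ∧ a ∈ C (E \ ω) b
    · rw [if_pos h1, if_pos h1, if_pos h1, if_pos h1]
      have e : (ha₁ (C ω a) - hb₀ (C (E \ ω) b)) * (ka₁ (C ω a) - kb₀ (C (E \ ω) b)) =
          ha₁ (C ω a) * ka₁ (C ω a) - ha₁ (C ω a) * kb₀ (C (E \ ω) b) - ka₁ (C ω a) * hb₀ (C (E \ ω) b)
            + hb₀ (C (E \ ω) b) * kb₀ (C (E \ ω) b) := by ring
      rw [e]
      linarith [mul_nonneg (ha0 (C ω a)) (ka0 (C ω a))]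
    · rw [if_neg h1, if_neg h1, if_neg h1, if_neg h1]; linarith
  -- the pointwise inequality on `ℜ ∖ 𝔅`
  have final : 0 ≤ ∑ ω ∈ E.powerset, (if b ∈ C ω a ∧ a ∉ C (E \ ω) b then
      (h₁ (C ω a ∪ C ω b) * k₁ (C ω a ∪ C ω b) + hb₀ (C ω a ∪ C ω b) * kb₀ (C ω a ∪ C ω b)
        - ha₁ (C ω a ∪ C ω b) * kb₀ (C ω a ∪ C ω b) - ka₁ (C ω a ∪ C ω b) * hb₀ (C ω a ∪ C ω b)) else 0) := by
    refine Finset.sum_nonneg fun ω _ => ?_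
    by_cases h1 : b ∈ C ω a ∧ a ∉ C (E \ ω) b
    · rw [if_pos h1]
      have := kernelMix_pointwise (w := h₁ (C ω a ∪ C ω b)) (u := hb₀ (C ω a ∪ C ω b)) (v := ha₁ (C ω a ∪ C ω b))
        (w' := k₁ (C ω a ∪ C ω b)) (u' := kb₀ (C ω a ∪ C ω b)) (v' := ka₁ (C ω a ∪ C ω b))
        (hb0 _) (hbh _) (hah _) (kb0 _) (kbk _) (kak _)
      linarith
    · rw [if_neg h1]
  have final_split : ∑ ω ∈ E.powerset, (if b ∈ C ω a ∧ a ∉ C (E \ ω) b then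
      (h₁ (C ω a ∪ C ω b) * k₁ (C ω a ∪ C ω b) + hb₀ (C ω a ∪ C ω b) * kb₀ (C ω a ∪ C ω b)
        - ha₁ (C ω a ∪ C ω b) * kb₀ (C ω a ∪ C ω b) - ka₁ (C ω a ∪ C ω b) * hb₀ (C ω a ∪ C ω b)) else 0)
      = (∑ ω ∈ E.powerset, (if b ∈ C ω a ∧ a ∉ C (E \ ω) b then h₁ (C ω a ∪ C ω b) * k₁ (C ω a ∪ C ω b) else 0))
        + (∑ ω ∈ E.powerset, (if b ∈ C ω a ∧ a ∉ C (E \ ω) b then hb₀ (C ω a ∪ C ω b) * kb₀ (C ω a ∪ C ω b) else 0))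
        - (∑ ω ∈ E.powerset, (if b ∈ C ω a ∧ a ∉ C (E \ ω) b then ha₁ (C ω a ∪ C ω b) * kb₀ (C ω a ∪ C ω b) else 0))
        - (∑ ω ∈ E.powerset, (if b ∈ C ω a ∧ a ∉ C (E \ ω) b then ka₁ (C ω a ∪ C ω b) * hb₀ (C ω a ∪ C ω b) else 0)) := by
    rw [← Finset.sum_add_distrib, ← Finset.sum_sub_distrib, ← Finset.sum_sub_distrib]
    refine Finset.sum_congr rfl fun ω _ => ?_
    split_ifs <;> ring
  -- assemble
  rw [Finset.sum_add_distrib, swap_i] at step_i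
  rw [H1split]
  linarith [H1on, cross1, cross2, sq_swap, step_iii, final, final_split, step_i]

end Coefficientwise

end Summit.CriticalPhenomena.PercolationContinuityZ3.Theorems
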